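import Literature.NumberTheory.GaloisRepresentations.LocalBrauerCyclicity
import Literature.NumberTheory.GaloisRepresentations.KummerSES
import Literature.NumberTheory.GaloisRepresentations.ContinuousCohomologyConnecting
import HarnessLib

/-!
# `H²(Gal(F̄/E), μ_n)` is cyclic of order dividing `n` (local field, characteristic `0`)

For a non-archimedean local field `F` of characteristic `0`, a finite `E ⊆ F̄` with group
`Γ_E = Gal(F̄/E) ≤ Γ_F` (`galFixing F E`) and `n ≥ 1`, we construct an **injective homomorphism
`ι : H²(Γ_E, μ_n) → ℤ/n`** (`exists_injective_iota`), the invariant-type map fed to the local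
duality engine (`TateDualityDevissage.lean`).  Steps:

* `kummerTwo_injective` — the Kummer map `H²(Γ_E, μ_n) → H²(Γ_E, F̄ˣ) = Br(E)` is injective
  (`0 → μ_n → F̄ˣ → F̄ˣ → 0`, exactness at `H²(μ_n)` (`exists_δ₁_eq_of_map_two_eq_zero`) and
  Hilbert 90 `H¹(Γ_E, F̄ˣ) = 0`), for any closed subgroup with Hilbert 90;
* `zsmul_two_mu_eq_zero` — `H²(Γ_E, μ_n)` is killed by `n`;
* `exists_mem_zmultiples_pair_mu` — any two classes of `H²(Γ_E, μ_n)` lie in a common cyclic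
  subgroup (from the same statement for `Br(E)`, `exists_mem_zmultiples_pair`, and injectivity);
* `exists_injective_addMonoidHom_zmod` — a group of exponent `n` in which any two elements lie in
  a common cyclic subgroup is cyclic of order `d ∣ n`, hence embeds in `ℤ/n`.

## References
* J.-P. Serre, *Corps locaux*, Hermann, 1968, XIII §3 Cor. 3; X §4. [SerreLocalFields1979]
* J.-P. Serre, *Galois Cohomology*, Springer, 1997, II §1.2, II §5.2. [SerreGaloisCohomology1997]
-/

noncomputable section

open CategoryTheory Function
open Field IsNonarchimedeanLocalField ValuativeRel IntermediateField

universe u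

namespace Literature.NumberTheory.GaloisRepresentations

open _root_.TopRep _root_.ContRepresentation _root_.ContinuousCohomology DiscreteGaloisModule
open LocalWeilDatum

/-! ### Locally cyclic groups of bounded exponent embed in `ℤ/n` -/

section Group

variable {B : Type*} [AddCommGroup B]

/-- **Two elements of a cyclic subgroup generate a cyclic subgroup**: if `a, b ∈ ℤu` then
`a, b ∈ ℤv` for some `v` in the subgroup generated by `a` and `b`. [folklore] -/
theorem exists_generator_of_mem_zmultiples {u a b : B} (ha : a ∈ AddSubgroup.zmultiples u)
    (hb : b ∈ AddSubgroup.zmultiples u) :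
    ∃ v ∈ AddSubgroup.closure ({a, b} : Set B),
      a ∈ AddSubgroup.zmultiples v ∧ b ∈ AddSubgroup.zmultiples v := by
  have hle : AddSubgroup.closure ({a, b} : Set B) ≤ AddSubgroup.zmultiples u :=
    (AddSubgroup.closure_le _).2 (by
      rintro x (rfl | rfl)
      · exact ha
      · exact hb)
  haveI := AddSubgroup.isAddCyclic_of_le hle
  obtain ⟨v, hv⟩ := (AddSubgroup.isAddCyclic_iff_exists_zmultiples_eq_top _).1
    (inferInstance : IsAddCyclic (AddSubgroup.closure ({a, b} : Set B)))
  refine ⟨v, ?_, ?_, ?_⟩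
  · rw [← hv]
    exact AddSubgroup.mem_zmultiples v
  · rw [hv]
    exact AddSubgroup.subset_closure (by simp)
  · rw [hv]
    exact AddSubgroup.subset_closure (by simp)

/-- **A group of exponent `n` in which any two elements lie in a common cyclic subgroup is cyclic,
generated by any element of maximal order.** [folklore] -/
theorem exists_forall_mem_zmultiples {n : ℕ} [NeZero n] (hn : ∀ b : B, n • b = 0)
    (hlc : ∀ x y : B, ∃ u : B, x ∈ AddSubgroup.zmultiples u ∧ y ∈ AddSubgroup.zmultiples u) :
    ∃ x₀ : B, ∀ y, y ∈ AddSubgroup.zmultiples x₀ := by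
  classical
  -- an element of maximal order (orders divide `n`)
  have hfin : ((fun b : B => addOrderOf b) '' Set.univ).Finite := by
    refine (Set.finite_le_nat n).subset ?_
    rintro _ ⟨b, -, rfl⟩
    exact Nat.le_of_dvd (NeZero.pos n) (addOrderOf_dvd_of_nsmul_eq_zero (hn b))
  obtain ⟨x₀, -, hmax⟩ := Set.Finite.exists_maximalFor' (fun b : B => addOrderOf b) Set.univ hfin
    ⟨0, Set.mem_univ _⟩
  refine ⟨x₀, fun y => ?_⟩
  obtain ⟨u, hx, hy⟩ := hlc x₀ y
  have h1 : addOrderOf x₀ ∣ addOrderOf u := addOrderOf_dvd_of_mem_zmultiples hx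
  have hu0 : 0 < addOrderOf u := addOrderOf_pos_iff.2 (isOfFinAddOrder_iff_nsmul_eq_zero.2
    ⟨n, NeZero.pos n, hn u⟩)
  have h2 : addOrderOf u ≤ addOrderOf x₀ := hmax (Set.mem_univ u) (Nat.le_of_dvd hu0 h1)
  have heq : addOrderOf x₀ = addOrderOf u := le_antisymm (Nat.le_of_dvd hu0 h1) h2
  -- `ℤ x₀ = ℤ u`
  haveI : Finite (AddSubgroup.zmultiples u) := Nat.finite_of_card_ne_zero (by
    rw [Nat.card_zmultiples]; exact hu0.ne')
  have hsub : AddSubgroup.zmultiples x₀ = AddSubgroup.zmultiples u :=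
    AddSubgroup.eq_of_le_of_card_ge (AddSubgroup.zmultiples_le.2 hx)
      (by rw [Nat.card_zmultiples, Nat.card_zmultiples, heq])
  rw [hsub]
  exact hy

/-- **Embedding of a cyclic group of order `d ∣ n` into `ℤ/n`**, `1 ↦ n/d`. [folklore] -/
theorem exists_injective_zmod_to_zmod {d n : ℕ} [NeZero d] [NeZero n] (hdn : d ∣ n) :
    ∃ e : ZMod d →+ ZMod n, Injective e := by
  obtain ⟨m, hm⟩ := hdn
  have hm0 : 0 < m := Nat.pos_of_ne_zero fun h => NeZero.ne n (by rw [hm, h, mul_zero])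
  let f : ℤ →+ ZMod n := zmultiplesHom (ZMod n) ((m : ℕ) : ZMod n)
  have hf : f d = 0 := by
    change (d : ℤ) • ((m : ℕ) : ZMod n) = 0
    rw [natCast_zsmul, nsmul_eq_mul, ← Nat.cast_mul, ← hm, ZMod.natCast_self]
  refine ⟨ZMod.lift d ⟨f, hf⟩, (ZMod.lift_injective d).2 fun k hk => ?_⟩
  change k • ((m : ℕ) : ZMod n) = 0 at hk
  rw [zsmul_eq_mul, ← Int.cast_natCast, ← Int.cast_mul, ZMod.intCast_zmod_eq_zero_iff_dvd, hm,
    Nat.cast_mul] at hk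
  rw [ZMod.intCast_zmod_eq_zero_iff_dvd]
  exact (mul_dvd_mul_iff_right (by exact_mod_cast hm0.ne')).1 hk

/-- **A group of exponent `n` in which any two elements lie in a common cyclic subgroup embeds in
`ℤ/n`.** [folklore] -/
theorem exists_injective_addMonoidHom_zmod {n : ℕ} [NeZero n] (hn : ∀ b : B, n • b = 0)
    (hlc : ∀ x y : B, ∃ u : B, x ∈ AddSubgroup.zmultiples u ∧ y ∈ AddSubgroup.zmultiples u) :
    ∃ ι : B →+ ZMod n, Injective ι := by
  classical
  obtain ⟨x₀, hx₀⟩ := exists_forall_mem_zmultiples hn hlc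
  have hd0 : 0 < addOrderOf x₀ := addOrderOf_pos_iff.2 (isOfFinAddOrder_iff_nsmul_eq_zero.2
    ⟨n, NeZero.pos n, hn x₀⟩)
  haveI : NeZero (addOrderOf x₀) := ⟨hd0.ne'⟩
  have hcard : Nat.card B = addOrderOf x₀ := by
    rw [← Nat.card_zmultiples, (AddSubgroup.eq_top_iff' _).2 hx₀, AddSubgroup.card_top]
  let e : ZMod (addOrderOf x₀) ≃+ B := zmodAddEquivOfGenerator hx₀ hcard
  obtain ⟨emb, hemb⟩ := exists_injective_zmod_to_zmod (d := addOrderOf x₀) (n := n)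
    (addOrderOf_dvd_of_nsmul_eq_zero (hn x₀))
  exact ⟨emb.comp e.symm.toAddMonoidHom, hemb.comp e.symm.injective⟩

end Group

/-! ### The Kummer map `H²(S, μ_n) → H²(S, K̄ˣ)` -/

section Kummer

variable (k : Type u) [Field k] [CharZero k] (S : Subgroup (absoluteGaloisGroup k))
  [hS : IsClosed (S : Set (absoluteGaloisGroup k))]

attribute [local instance] compactSpace_of_isClosed_subgroup

/-- **The Kummer map `H²(S, μ_n) → H²(S, K̄ˣ)`** (for a closed `S ≤ Γ_k`), induced by the inclusion
`μ_n → K̄ˣ`. [cite: SerreGaloisCohomology1997, II §1.2] -/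
abbrev kummerTwo (n : ℕ) :
    continuousCohomology 2 ((mu k n).restrict (subgroupIncl S)).toTopRep ⟶
      continuousCohomology 2 ((units k).restrict (subgroupIncl S)).toTopRep :=
  cohomologyMap (resModHom S (kummerι k n)) 2

/-- **The Kummer map on `H²` is injective when `H¹(S, K̄ˣ) = 0`** (e.g. `S = Gal(K̄/E)`,
Hilbert 90): exactness of `H¹(S, K̄ˣ) → H²(S, μ_n) → H²(S, K̄ˣ)`.
[cite: SerreGaloisCohomology1997, II §1.2; SerreLocalFields1979, X §4] -/
theorem kummerTwo_injective {n : ℕ} (hn : 0 < n)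
    (h90 : Subsingleton (continuousCohomology 1 ((units k).restrict (subgroupIncl S)).toTopRep)) :
    Injective (kummerTwo k S n) := by
  have hSES : IsSES (resModHom S (kummerι k n)) (resModHom S (kummerπ k n)) :=
    (isSES_kummer k n hn).res S
  refine (injective_iff_map_eq_zero _).2 fun z hz => ?_
  obtain ⟨x, rfl⟩ := hSES.exists_δ₁_eq_of_map_two_eq_zero z hz
  rw [Subsingleton.elim x 0, map_zero]

/-- **`H²(S, μ_n)` is killed by `n`.** [folklore] -/
theorem nsmul_two_mu_eq_zero (n : ℕ) (z : continuousCohomology 2 ((mu k n).restrict (subgroupIncl S)).toTopRep) :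
    n • z = 0 := by
  obtain ⟨c, rfl⟩ := twoCocycleClass_surjective _ z
  have hc : n • c = 0 := Subtype.ext (ContinuousMap.ext fun q => by
    change n • c.1 q = 0
    rw [← natCast_zsmul]
    exact zsmul_muCarrier_eq_zero k n (c.1 q))
  rw [← twoCocycleClassₗ_apply, ← map_nsmul, hc, map_zero]

/-- `(n : ℤ) • z = 0` for `z ∈ H²(S, μ_n)`. [folklore] -/
theorem zsmul_two_mu_eq_zero (n : ℕ) (z : continuousCohomology 2 ((mu k n).restrict (subgroupIncl S)).toTopRep) :
    (n : ℤ) • z = 0 := by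
  rw [natCast_zsmul]
  exact nsmul_two_mu_eq_zero k S n z

end Kummer

/-! ### The local field: `H²(Gal(F̄/E), μ_n) ↪ ℤ/n` -/

section Local

variable (F : Type u) [Field F] [ValuativeRel F] [TopologicalSpace F] [IsNonarchimedeanLocalField F]
  [CharZero F]
variable (E : IntermediateField F (AlgebraicClosure F)) [FiniteDimensional F E]

attribute [local instance] compactSpace_of_isClosed_subgroup isClosed_galFixing'

/-- **Any two classes of `H²(Gal(F̄/E), μ_n)` lie in a common cyclic subgroup** (from the same
property of `Br(E)` and the injectivity of the Kummer map). [cite: SerreLocalFields1979, XIII §3 Cor. 3] -/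
theorem exists_mem_zmultiples_pair_mu {n : ℕ} (hn : 0 < n)
    (x y : continuousCohomology 2 ((mu F n).restrict (subgroupIncl (galFixing F E))).toTopRep) :
    ∃ w : continuousCohomology 2 ((mu F n).restrict (subgroupIncl (galFixing F E))).toTopRep,
      x ∈ AddSubgroup.zmultiples w ∧ y ∈ AddSubgroup.zmultiples w := by
  have hinj := kummerTwo_injective F (galFixing F E) hn (subsingleton_one_units_galFixing E)
  let j := kummerTwo F (galFixing F E) n
  obtain ⟨u, hx, hy⟩ := exists_mem_zmultiples_pair F E (j x) (j y)
  obtain ⟨v, hv, hxv, hyv⟩ := exists_generator_of_mem_zmultiples hx hy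
  -- `v` is in the image of the Kummer map
  have hvr : v ∈ (j : _ ⟶ _).hom.toLinearMap.toAddMonoidHom.range := by
    refine (AddSubgroup.closure_le _).2 ?_ hv
    rintro _ (rfl | rfl)
    · exact ⟨x, rfl⟩
    · exact ⟨y, rfl⟩
  obtain ⟨w, rfl⟩ := hvr
  refine ⟨w, ?_, ?_⟩
  · obtain ⟨i, hi⟩ := AddSubgroup.mem_zmultiples_iff.1 hxv
    refine AddSubgroup.mem_zmultiples_iff.2 ⟨i, hinj ?_⟩
    rw [map_zsmul]
    exact hi
  · obtain ⟨i, hi⟩ := AddSubgroup.mem_zmultiples_iff.1 hyv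
    refine AddSubgroup.mem_zmultiples_iff.2 ⟨i, hinj ?_⟩
    rw [map_zsmul]
    exact hi

/-- **`H²(Gal(F̄/E), μ_n)` embeds in `ℤ/n`**: it is cyclic of order dividing `n`
(`exists_mem_zmultiples_pair_mu`, `nsmul_two_mu_eq_zero`, `exists_injective_addMonoidHom_zmod`).
For the non-archimedean local field `E` this is the injectivity half of `inv_E : Br(E)[n] ≅ ℤ/n`.
[cite: SerreLocalFields1979, XIII §3 Cor. 3; SerreGaloisCohomology1997, II §5.2] -/
theorem exists_injective_iota (n : ℕ) [NeZero n] :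
    ∃ ι : continuousCohomology 2 ((mu F n).restrict (subgroupIncl (galFixing F E))).toTopRep →+ ZMod n,
      Injective ι :=
  exists_injective_addMonoidHom_zmod (nsmul_two_mu_eq_zero F (galFixing F E) n)
    (exists_mem_zmultiples_pair_mu F E (NeZero.pos n))

end Local

end Literature.NumberTheory.GaloisRepresentations

end
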